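import Summits.QuantumFields.YangMills.Theorems.BalabanUVNodesN16HolderAtRecord13OfEdges
import Summits.QuantumFields.YangMills.Theorems.BalabanUVNodesN16AtRecord13SepOfEdges
/-!
# Route «BalabanUVNodes», cluster K4 «SpineRates» — node N16 = NE3 AT THE STAGE-13 READING OF RECORD FROM ITS TWO IN-EDGES BY NAME, LETTERS CHOSEN — THE R-β CURRENCY
# (dag-n16-c's candidate stub `S_N16Holder β`, nearest-neighbour Hölder reading, `0 ≤ β ≤ 1`): N05's leaf on `zdGF3 (M_N ℂ) F.L β len` and N07's LINEAR leaf, once per family,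
# give SOME letters of record `ℓ₃` with `S_N16Holder β (RRec₁₃SepOn (readingOfRecord₁₃Sep w1 ℓ₃ ne2 ne1) Rg)` TOGETHER WITH dag-n21-d's numerals and the β-uniform proviso

⁗ EDITION (Record13Sep re-key, 2026-08-27): director-ym №136–№139 ⇒ node00-def-T `Node00/Record13.lean` v1.2 (p501191, DEPRECATE-AND-ADD) minted the SEPARATED
proviso `Stage13Params.Provisos₁₃Sep` (row P11's `bg` asked only at separated, part-compatible sequences) with `datumOfRecord₁₃Sep` ∕ `IsRecordOfRecord₁₃CSep`; RR-2's key twin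
`Node00/Record13DatumKeySep` (`IsDatumOfRecord₁₃CSep(On∕N)`), dag-n22-e g6's (T-RATE) layer-B twins (`RateReading₁₃Sep`, `rateCarriersOfRecord₁₃Sep`, `RRec₁₃Sep`, `RRec₁₃SepOn`,
`readingOfRecord₁₃Sep`, …) and plan's rev 18 (⁗ items keyed FLAT on `Provisos₁₃Sep`) followed.  THIS FILE is the TOKEN TWIN of this seat's ‴ module of the same name without
`Sep` under that map — statements = the ‴ statements with `Provisos₁₃ ↦ Provisos₁₃Sep`, `datumOfRecord₁₃ ↦ datumOfRecord₁₃Sep`, `(Is|is)DatumOfRecord₁₃C… ↦ …₁₃CSep…`, the layer-B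
names suffixed after `₁₃`; proofs = the ‴ proofs verbatim; θ-level names (`Stage13Params`, `Admissible`, `unityNondeg₁₃`, RR-1's `ne3ConstLayerOfRecord₁₁`, …) VERBATIM; stage-free
lemmas are NOT re-declared (imported from the ‴ modules BY NAME).  The ‴ item ids named below are ASIDES after rev 18; the lane is the ⁗ K3 id per dag-lead's KEY MAP.

Cell `pub-ymgap`, seat `pub-ymgap-dag-n16-e` (R134 acceleration seat (a), strategy s2 = BY-NAME KNIT at the record; HUMAN RULING D-0062; chair R424 venue), generation 6,
module 28 (THEOREMS ONLY, 0 `def`, 0 `sorry`) — the third currency of module 27 `…N16AtRecord13SepOfEdges` (β = 1 and R-β″ there), over this seat's (F2) `…N16HolderSlotWindow`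
(`leafSlotHolder_ofRecord_of_window_linear`, `inEndRegimeH_ofRecord_of_window`, p485315), dag-n16-c's (E1) thresholds `radiusOfRecordH` ∕ `constOfRecordH` (p482644) and module 20's
const-layer closers `s_N16Holder_rRec₁₃Sep(On)_of_constLayer_leafSlotHolder` (p494677).  `bears_on: R4∕N16 · edges N05 → N16, N07 → N16 · out-edge N16 → N21 · K3‴ SpineGivenEndpointR13
(stmt-QuantumFields-19912, `--supports … --as helper`)`.

CONTENT.  (The per-family `exists_letters_inEndRegimeH_leafSlotHolder_of_edges` is the ‴ module's, stage-free, imported BY NAME — per family: `∃ ℓ`, `ℓ.g = g`, `ℓ.Λ₁ = radiusOfRecordH …`, `ℓ.C = constOfRecordH … g`, N21's numerals, and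
`InEndRegimeH ∧ LeafSlotHolder · β` at RR-1's object — module 27's THRESHOLD-PARAMETRIC witness `exists_window_letters_linearLeaf` at the H-thresholds), ★
`exists_letters_s_N16Holder_readingOfRecord₁₃SepOn_of_edges` (`∃ ℓ₃`, the composer's would-be `h16` under R-β at dag-n22-e's named reading, `hpin := rfl`),
`exists_letters_s_N16Holder_readingOfRecord₁₃Sep_of_edges` (canonical home).  The in-edge interfaces are module 27's: N05 = Thm-4 ∕ Prop-3 bodies on the univ sub-family of
`zdGF3 (M_N ℂ) F.L β len` (`len (e μ) = 1`) with constants + window; N07 = linear `LeafH3sup … ε (C·ε) (C·ε)` below a class-radius threshold; both UNGUARDED.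

HONEST FRAMING.  Kernel bookkeeping by name + module 27's letter arithmetic; no estimate; N05's `Thm4Body` ∕ `Prop3Body` ([Balaban1985RegularSpaces] Thm 4 ∕ Prop 3 as typed by
n05-a) and N07's linear `LeafH3sup` ([Balaban1985Variational] Thm 1 (8)+(10) TYPE) are HYPOTHESES asserted for no family — the file CHOOSES LETTERS and proves neither edge;
`S_N16Holder β` is a CANDIDATE stub (R-β UNRULED; nothing of record edited); localisation letters of the slot witness degenerate (files 17 ∕ 18); the reading's `w1` ∕ `ne2` ∕ `ne1` are
residual DATA; no admissible Stage-13 tuple with provisos is claimed to exist (K0‴ OPEN); nothing of Bałaban's asserted; **N16 ∕ NE3 is NOT discharged**; count-neutral (typed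
28∕28 · discharged 5∕27, A 5∕28 UNMOVED); one finite four-torus at fixed ε — NOT ℝ⁴, NOT infinite volume, NOT OS, NOT a mass gap, NOT Clay.  No decl below carries a cite tag.
-/

set_option autoImplicit false

open scoped BigOperators Matrix Matrix.Norms.L2Operator
open NormedSpace

namespace Summit.QuantumFields.YangMills.BalabanUVNodes.N16HolderAtRecord13SepOfEdges

open Literature.MathematicalPhysics.QuantumFieldTheory.Balaban1983to89
open Literature.MathematicalPhysics.QuantumFieldTheory.Balaban1983to89.T4Continuum (T4Family ULoop)
open B7Prop1Explicit B7Prop2Explicit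
open B7Prop3Flat (c3)
open B8LeafModelZd (ZdIdx)
open B8LeafModelZd3 (zdGF3)
open Node00 (IsDatumOfRecord₁₃CSep Stage13Params NE3Objects₁₁ NE3Letters₁₁ NE2Objects₁₁ ne3ConstLayerOfRecord₁₁ ne3NperOfRecord₁₁ ne3DomOfRecord₁₁ one_le_ne3NperOfRecord₁₁
  MatA)
open Node00.W1 (ReadingData)
open Summit.QuantumFields.BalabanUV.T4Continuum
open BlockAverageCurrent (curConst)
open NE3RightInverseSupLetters (frameC)
open NE3.LeafIndexSockets (LeafH3sup)
open YMDAG.UVSplit (Datum NE3Carriers NE1pCarriers ne3OfRecord₁₁ RRec₁₃Sep RRec₁₃SepOn readingOfRecord₁₃Sep)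
open Summit.QuantumFields.YangMills.BalabanUVNodes.N16HolderDefs (S_N16Holder)
open Summit.QuantumFields.YangMills.BalabanUVNodes.N16HolderRegime (InEndRegimeH radiusOfRecordH constOfRecordH radiusOfRecordH_pos)
open Summit.QuantumFields.YangMills.BalabanUVNodes.N16HolderLeafSlot (LeafSlotHolder)
open Summit.QuantumFields.YangMills.BalabanUVNodes.N16AtRRec13SepLines (s_N16Holder_rRec₁₃SepOn_of_constLayer_leafSlotHolder s_N16Holder_rRec₁₃Sep_of_constLayer_leafSlotHolder)
open Summit.QuantumFields.YangMills.BalabanUVNodes.N16HolderAtRecord13OfEdges (exists_letters_inEndRegimeH_leafSlotHolder_of_edges)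

noncomputable section

variable {N : ℕ} [NeZero N] {β : ℝ} (hβ0 : 0 ≤ β) (hβ1 : β ≤ 1) (Rg : (F : T4Family) → Stage13Params F N → Prop)
  (w1 : (F : T4Family) → (θ : Stage13Params F N) → ReadingData F (MatA N) θ.τ9.M)
  (ne2 : (F : T4Family) → Stage13Params F N → (ℕ → ℝ) → List (ULoop F) → ℕ → NE2Objects₁₁)
  (ne1 : (F : T4Family) → Stage13Params F N → (ℕ → ℝ) → List (ULoop F) → NE1pCarriers)

include hβ0 hβ1

/-- ★ **N16 UNDER R-β AT THE REGIME-RESTRICTED READING OF RECORD FROM ITS TWO IN-EDGES, LETTERS CHOSEN** (`0 ≤ β ≤ 1`): N05's unpacked leaf at exponent `β` and N07's linear leaf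
at every family, `g F > 0`, give letters `ℓ₃` with `S_N16Holder β (RRec₁₃SepOn (readingOfRecord₁₃Sep w1 ℓ₃ ne2 ne1) Rg)` AND the per-family β-uniform proviso, leaf β-slot and N21's
numerals (module 20 §2b's const-layer closer at `hpin := rfl`). [folklore] -/
theorem exists_letters_s_N16Holder_readingOfRecord₁₃SepOn_of_edges {g : T4Family → ℝ} (hg : ∀ F, 0 < g F)
    (h5 : ∀ F : T4Family, letI : CStarAlgebra (Matrix (Fin N) (Fin N) ℂ) := {}
      ∃ (len : Site 4 → ℝ) (c₁ c₁' B₁' cP C₂ B₀β : ℝ) (inp : B8.B9Inputs),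
        (∀ v : Site 4, 0 < len v → 1 ≤ len v) ∧ (∀ μ : Fin 4, len (e μ) = 1) ∧ 0 < B₁' ∧ 5 * ((4 : ℕ) : ℝ) * F.L * inp.B₀ ≤ B₁' ∧ 0 < c₁' ∧
        (∀ α₀ α₁ : ℝ, 0 < α₀ → 0 < α₁ → α₀ + α₁ ≤ c₁' →
          α₀ + α₁ ≤ c₁ ∧ C0 4 * (2 * α₀) ≤ 1 / 3 ∧ 4 * α₀ ≤ c2' 4 F.L ∧ 16 * (B₁' * (α₀ + α₁)) ≤ 1 ∧
          Real.exp (4 * (800 * (((4 : ℕ) : ℝ) + 1) ^ 2 * (((4 : ℕ) : ℝ) + 4)) * α₀) * (1 + 8 * (131072 * (((4 : ℕ) : ℝ) + 1) ^ 2) * (B₁' * (α₀ + α₁))) ≤ 2 ∧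
          2 * (B₁' * (α₀ + α₁)) ≤ c3 4 F.L ∧ ((4 : ℕ) : ℝ) * F.L * α₁ ≤ 1 / 8 ∧ α₀ ≤ cP ∧ α₁ ≤ cP ∧ B₁' * (α₀ + α₁) ≤ cP ∧
          2 * (B₁' * (α₀ + α₁)) ^ 2 + 20 * ((4 : ℕ) : ℝ) * α₀ * (B₁' * (α₀ + α₁)) + 2 * C₂ * (B₁' * (α₀ + α₁)) ^ 2 ≤ α₀ + α₁) ∧
        B8.Thm4Body c₁ B₁' (fun i : {i : ZdIdx 4 F.L // i.Ω 0 = Set.univ} => (zdGF3 (Matrix (Fin N) (Fin N) ℂ) F.L β len i.1).toGFData) ∧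
        B8.Prop3Body cP 4 (F.L : ℝ) C₂ inp B₀β (fun i : {i : ZdIdx 4 F.L // i.Ω 0 = Set.univ} => (zdGF3 (Matrix (Fin N) (Fin N) ℂ) F.L β len i.1).toGFData2))
    (h7 : ∀ F : T4Family, ∃ C ε₀ : ℝ, 0 ≤ C ∧ 0 < ε₀ ∧ ∀ ε : ℝ, 0 < ε → ε ≤ ε₀ →
      LeafH3sup 4 F.L (ne3NperOfRecord₁₁ F 0 0) ε (C * ε) (C * ε) (ne3DomOfRecord₁₁ F N 0 0)) :
    ∃ ℓ₃ : T4Family → NE3Letters₁₁,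
      S_N16Holder β (RRec₁₃SepOn (readingOfRecord₁₃Sep w1 ℓ₃ ne2 ne1) Rg) ∧
      ∀ F : T4Family, (ℓ₃ F).g = g F ∧ (ℓ₃ F).Λ₁ = radiusOfRecordH N F.L (ne3NperOfRecord₁₁ F 0 0) ∧
        (ℓ₃ F).C = constOfRecordH N F.L (ne3NperOfRecord₁₁ F 0 0) (g F) ∧
        0 < (ℓ₃ F).b ∧ 512 * (4 + 1) * (4 + 4) * (F.L : ℝ) ^ 2 * (ℓ₃ F).b ≤ 1 ∧ 0 < (ℓ₃ F).Λ₂' ∧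
        InEndRegimeH (ne3OfRecord₁₁ F (ne3ConstLayerOfRecord₁₁ F N (ℓ₃ F))) ∧ LeafSlotHolder (ne3OfRecord₁₁ F (ne3ConstLayerOfRecord₁₁ F N (ℓ₃ F))) β := by
  choose ℓ₃ hℓ₃ using fun F => exists_letters_inEndRegimeH_leafSlotHolder_of_edges (N := N) (β := β) F (hg F) (h5 F) (h7 F)
  exact ⟨ℓ₃, s_N16Holder_rRec₁₃SepOn_of_constLayer_leafSlotHolder β _ Rg hβ0 hβ1 (fun F => ne3ConstLayerOfRecord₁₁ F N (ℓ₃ F)) (fun _ _ _ _ _ _ => rfl)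
    (fun F _ => (hℓ₃ F).2.2.2.2.2.2), hℓ₃⟩

/-- **THE SAME AT THE CANONICAL READING OF RECORD** (`S_N16Holder β (RRec₁₃Sep (readingOfRecord₁₃Sep w1 ℓ₃ ne2 ne1))`). [folklore] -/
theorem exists_letters_s_N16Holder_readingOfRecord₁₃Sep_of_edges {g : T4Family → ℝ} (hg : ∀ F, 0 < g F)
    (h5 : ∀ F : T4Family, letI : CStarAlgebra (Matrix (Fin N) (Fin N) ℂ) := {}
      ∃ (len : Site 4 → ℝ) (c₁ c₁' B₁' cP C₂ B₀β : ℝ) (inp : B8.B9Inputs),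
        (∀ v : Site 4, 0 < len v → 1 ≤ len v) ∧ (∀ μ : Fin 4, len (e μ) = 1) ∧ 0 < B₁' ∧ 5 * ((4 : ℕ) : ℝ) * F.L * inp.B₀ ≤ B₁' ∧ 0 < c₁' ∧
        (∀ α₀ α₁ : ℝ, 0 < α₀ → 0 < α₁ → α₀ + α₁ ≤ c₁' →
          α₀ + α₁ ≤ c₁ ∧ C0 4 * (2 * α₀) ≤ 1 / 3 ∧ 4 * α₀ ≤ c2' 4 F.L ∧ 16 * (B₁' * (α₀ + α₁)) ≤ 1 ∧
          Real.exp (4 * (800 * (((4 : ℕ) : ℝ) + 1) ^ 2 * (((4 : ℕ) : ℝ) + 4)) * α₀) * (1 + 8 * (131072 * (((4 : ℕ) : ℝ) + 1) ^ 2) * (B₁' * (α₀ + α₁))) ≤ 2 ∧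
          2 * (B₁' * (α₀ + α₁)) ≤ c3 4 F.L ∧ ((4 : ℕ) : ℝ) * F.L * α₁ ≤ 1 / 8 ∧ α₀ ≤ cP ∧ α₁ ≤ cP ∧ B₁' * (α₀ + α₁) ≤ cP ∧
          2 * (B₁' * (α₀ + α₁)) ^ 2 + 20 * ((4 : ℕ) : ℝ) * α₀ * (B₁' * (α₀ + α₁)) + 2 * C₂ * (B₁' * (α₀ + α₁)) ^ 2 ≤ α₀ + α₁) ∧
        B8.Thm4Body c₁ B₁' (fun i : {i : ZdIdx 4 F.L // i.Ω 0 = Set.univ} => (zdGF3 (Matrix (Fin N) (Fin N) ℂ) F.L β len i.1).toGFData) ∧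
        B8.Prop3Body cP 4 (F.L : ℝ) C₂ inp B₀β (fun i : {i : ZdIdx 4 F.L // i.Ω 0 = Set.univ} => (zdGF3 (Matrix (Fin N) (Fin N) ℂ) F.L β len i.1).toGFData2))
    (h7 : ∀ F : T4Family, ∃ C ε₀ : ℝ, 0 ≤ C ∧ 0 < ε₀ ∧ ∀ ε : ℝ, 0 < ε → ε ≤ ε₀ →
      LeafH3sup 4 F.L (ne3NperOfRecord₁₁ F 0 0) ε (C * ε) (C * ε) (ne3DomOfRecord₁₁ F N 0 0)) :
    ∃ ℓ₃ : T4Family → NE3Letters₁₁,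
      S_N16Holder β (RRec₁₃Sep (readingOfRecord₁₃Sep w1 ℓ₃ ne2 ne1)) ∧
      ∀ F : T4Family, (ℓ₃ F).g = g F ∧ (ℓ₃ F).Λ₁ = radiusOfRecordH N F.L (ne3NperOfRecord₁₁ F 0 0) ∧
        (ℓ₃ F).C = constOfRecordH N F.L (ne3NperOfRecord₁₁ F 0 0) (g F) ∧
        0 < (ℓ₃ F).b ∧ 512 * (4 + 1) * (4 + 4) * (F.L : ℝ) ^ 2 * (ℓ₃ F).b ≤ 1 ∧ 0 < (ℓ₃ F).Λ₂' ∧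
        InEndRegimeH (ne3OfRecord₁₁ F (ne3ConstLayerOfRecord₁₁ F N (ℓ₃ F))) ∧ LeafSlotHolder (ne3OfRecord₁₁ F (ne3ConstLayerOfRecord₁₁ F N (ℓ₃ F))) β := by
  choose ℓ₃ hℓ₃ using fun F => exists_letters_inEndRegimeH_leafSlotHolder_of_edges (N := N) (β := β) F (hg F) (h5 F) (h7 F)
  exact ⟨ℓ₃, s_N16Holder_rRec₁₃Sep_of_constLayer_leafSlotHolder β _ hβ0 hβ1 (fun F => ne3ConstLayerOfRecord₁₁ F N (ℓ₃ F)) (fun _ _ _ _ _ _ => rfl)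
    (fun F _ => (hℓ₃ F).2.2.2.2.2.2), hℓ₃⟩

end

end Summit.QuantumFields.YangMills.BalabanUVNodes.N16HolderAtRecord13SepOfEdges
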